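import Summits.AnomalousDissipation.AnomalousDissipation.Theses.TwoAndHalfD
import Literature.Analysis.FluidPDE.TwoHalfNavierStokes
import Literature.Analysis.FluidPDE.TwoHalfSection
import Literature.Analysis.FluidPDE.LongTimeAverageNonneg
import Literature.Analysis.FluidPDE.LongTimeAverageShift
import Literature.Analysis.FluidPDE.LerayHopfRestartTorus
import Literature.Analysis.FluidPDE.PassiveScalarForced
import Literature.Analysis.FunctionSpaces.TorusCalculusProofs
import Summits.AnomalousDissipation.AnomalousDissipation.Theorems.TwoAndHalfDTwohalfdNegPlanarNoAnomaly
import Summits.AnomalousDissipation.AnomalousDissipation.Theorems.TwoAndHalfDTwohalfdNegReleaseLogBound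
import Summits.AnomalousDissipation.AnomalousDissipation.Theorems.TwoAndHalfDTwohalfdNegReductionOffZero
import Summits.AnomalousDissipation.AnomalousDissipation.Theorems.TwoAndHalfDTwohalfdNegQuietOfSubLogGrid
import Summits.AnomalousDissipation.AnomalousDissipation.Theorems.TwoAndHalfDTwohalfdNegAgeDecouplingGrid
import Summits.AnomalousDissipation.AnomalousDissipation.Theorems.TwoAndHalfDTwohalfdNegSubLogStrainSingleShell
import Summits.AnomalousDissipation.AnomalousDissipation.Theorems.TwoAndHalfDTwohalfdNegZeroSource
import Summits.AnomalousDissipation.AnomalousDissipation.Theorems.TwoAndHalfDTwohalfdNegCoscalarEnstrophyBound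
import Summits.AnomalousDissipation.AnomalousDissipation.Theorems.TwoAndHalfDTwohalfdNegSectionDatumH1
import Summits.AnomalousDissipation.AnomalousDissipation.Theorems.TwoAndHalfDTwohalfdNegVorticityTransport

/-!
# The CO-SCALAR sub-case of the crux `TwoAndHalfD.TwohalfdNeg` (stmt-AnomalousDissipation-0211):
# no zeroth law in the `x₃`-invariant class when the source is proportional to the planar torque

A sorry-free by-product of the checked skeleton
`Cruxes/TwohalfdNeg/Lines/log_kantorovich_enstrophy_transfer.lean` (line
`log-kantorovich-enstrophy-transfer`, lead c2): for EVERY smooth divergence-free mean-zero planar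
force `g` on `T²` — any number of Fourier shells — and every `c : ℝ`, every family of
`x₃`-invariant global Leray–Hopf solutions of NS_{ν_j} on `T³` forced by the `x₃`-invariant steady
field `twoHalf g (c·curl g) = (g, c·curl g) ∘ π`, with `ν_j → 0`, arbitrary `L²` data and
`ν`-uniformly bounded `limsup`-mean energy, has `meanDissipation (ν j) (u j) → 0`.

Mechanism (Prandtl number one): the planar vorticity `ω_j = curl v_j` solves the crux's own
scalar equation with source `curl g` (weak vorticity formulation,
`VorticityTransport.stub_vorticityTransport`, over the jointly measurable weak curl of
`WeakCurlWitness.stub_weakCurlWitness` and the nonlinear slice identity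
`WeakVorticityNonlinear.stub_weakVorticityNonlinear`), so `θ_j - cω_j` solves the FREE
advection–diffusion equation and is damped: bounded variance of the passive third component —
part of the 3-D energy ceiling — forces bounded planar ENSTROPHY,
`⟨‖∇v_j‖²⟩ ≤ (2/c²)⟨‖θ_j‖²⟩ ≤ (2/c²)E` (`CoscalarEnstrophyBound.stub_coscalarEnstrophyBound`),
hence sub-logarithmic strain, hence (S5′ fed with the log-Kantorovich engine S4, then the grid
age-decoupling S3′, and Alexakis–Doering S2) no anomalous dissipation. Bookkeeping: every member is
restarted at a good `H¹` time (`IsGlobalLerayHopf.exists_isGlobalLerayHopf_translate`; the means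
are shift invariant) and split by S1′ (`ReductionOffZero`), whose planar datum is rebased to the
`H¹` planar section (`SectionDatumH1.stub_sectionDatumH1`); `c = 0` is the landed zero-source
theorem (`ZeroSource.twohalfdNeg_twoHalf_zeroSource`).

With the single-shell theorem (`Certificate.twohalfdNeg_twoHalf_singleShell`) and the zero-source
theorem this is the third certified region of the crux; an `X`-witness (route TwoAndHalfD #2) must
carry a planar force on ≥ 2 shells AND a source `h ∉ ℝ·curl g`. The file closes with the
registered tools stub `stub_coscalarCertificate`. Supports stmt-AnomalousDissipation-0211.
-/

namespace Summit.AnomalousDissipation.AnomalousDissipation.Theorems.TwohalfdNeg.Coscalar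

open MeasureTheory Filter Topology
open scoped ENNReal NNReal
open Literature.Analysis.FunctionSpaces Literature.Analysis.FluidPDE
open Summit.AnomalousDissipation.AnomalousDissipation.Theorems.TwohalfdNeg

set_option linter.dupNamespace false

/-- **The co-scalar sub-case of the crux, from S1′, S2, S3′, S4, S5′ and S6-co (W, N, A, B, C′)**: for every
smooth divergence-free mean-zero planar force `g` (ANY number of shells) and every `c : ℝ`, every bounded-energy
family of `x₃`-invariant global Leray–Hopf solutions of NS_{ν_j} forced by `twoHalf g (c·curl g)`, `ν_j → 0`,
arbitrary `L²` data, has `meanDissipation → 0`. `c = 0` is the landed zero-source theorem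
(`ZeroSource.twohalfdNeg_twoHalf_zeroSource`, p120699). For `c ≠ 0`: restart every member at a good `H¹` time
(`IsGlobalLerayHopf.exists_isGlobalLerayHopf_translate`; means are shift invariant, `meanEnergy_translate`,
`meanDissipation_translate`), split with S1′, get `H¹` planar data (C′), the vorticity formulation (A) and the
enstrophy ceiling `⟨‖∇v_j‖²⟩ ≤ (2/c²)E` (B), Jensen (`TwohalfdThesis.longTimeAvgSup_sqrt_le_sqrt_add_one`),
`log(1/ν_j) → ∞`, then S5′(S4), S3′, S2 and the squeeze exactly as in `TwohalfdNeg_of`. [folklore] -/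
theorem twohalfdNeg_twoHalf_coscalar :
    ∀ (g : UnitAddTorus (Fin 2) → EuclideanSpace ℝ (Fin 2)) (c : ℝ),
      Torus.IsSmooth g → Torus.IsDivFree g → Torus.HasZeroMean g →
      ∀ (ν : ℕ → ℝ) (u₀ : ℕ → UnitAddTorus (Fin 3) → EuclideanSpace ℝ (Fin 3))
        (u : ℕ → ℝ → UnitAddTorus (Fin 3) → EuclideanSpace ℝ (Fin 3)),
        (∀ j, 0 < ν j) → Tendsto ν atTop (𝓝 0) →
        (∀ j, Torus.IsGlobalLerayHopf (ν j)
          (fun _ => Torus.twoHalf g (fun x => c * (Torus.partialDeriv 0 g x 1 - Torus.partialDeriv 1 g x 0)))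
          (u₀ j) (u j)) →
        (∀ j (t : ℝ) (s : UnitAddCircle) (x : UnitAddTorus (Fin 3)),
          u j t (x + Pi.single (2 : Fin 3) s) = u j t x) →
        (∃ E : ℝ, ∀ j, meanEnergy (u j) ≤ E) →
        Tendsto (fun j => meanDissipation (ν j) (u j)) atTop (𝓝 0) := by
  intro g c hgs hgd hgz ν u₀ u hν hν0 hLH huinv hE
  -- the source profile
  set h : UnitAddTorus (Fin 2) → ℝ := fun x => c * (Torus.partialDeriv 0 g x 1 - Torus.partialDeriv 1 g x 0) with hh_def
  by_cases hc : c = 0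
  · -- zero source: the landed purely-planar-force theorem
    have h0 : h = 0 := by funext x; simp [hh_def, hc]
    have hLH0 : ∀ j, Torus.IsGlobalLerayHopf (ν j) (fun _ => Torus.twoHalf g 0) (u₀ j) (u j) := by
      intro j; simpa only [h0] using hLH j
    exact Summit.AnomalousDissipation.AnomalousDissipation.Theorems.TwohalfdNeg.ZeroSource.twohalfdNeg_twoHalf_zeroSource
      g hgs hgd hgz ν u₀ u hν hν0 hLH0 huinv hE
  -- `c ≠ 0`: the co-scalar route
  have hhs : Torus.IsSmooth h := by
    have h1 : Torus.IsSmooth (fun x => Torus.partialDeriv 0 g x 1 - Torus.partialDeriv 1 g x 0) :=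
      ((hgs.partialDeriv 0).apply 1).sub ((hgs.partialDeriv 1).apply 0)
    exact h1.smul c
  have hhz : Torus.HasZeroMean h := by
    show ∫ x, h x = 0
    have i0 : Integrable (fun x => Torus.partialDeriv 0 g x 1) volume := ((hgs.partialDeriv 0).apply 1).integrable
    have i1 : Integrable (fun x => Torus.partialDeriv 1 g x 0) volume := ((hgs.partialDeriv 1).apply 0).integrable
    have e0 : ∫ x, Torus.partialDeriv 0 g x 1 = 0 := by
      have hc0 := (EuclideanSpace.proj (1 : Fin 2) : EuclideanSpace ℝ (Fin 2) →L[ℝ] ℝ).integral_comp_comm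
        (hgs.partialDeriv 0).integrable
      rw [show (∫ x, Torus.partialDeriv 0 g x 1) =
          ∫ x, (EuclideanSpace.proj (1 : Fin 2) : EuclideanSpace ℝ (Fin 2) →L[ℝ] ℝ) (Torus.partialDeriv 0 g x)
          from rfl, hc0, Torus.integral_partialDeriv_eq_zero_holds hgs 0]
      rfl
    have e1 : ∫ x, Torus.partialDeriv 1 g x 0 = 0 := by
      have hc1 := (EuclideanSpace.proj (0 : Fin 2) : EuclideanSpace ℝ (Fin 2) →L[ℝ] ℝ).integral_comp_comm
        (hgs.partialDeriv 1).integrable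
      rw [show (∫ x, Torus.partialDeriv 1 g x 0) =
          ∫ x, (EuclideanSpace.proj (0 : Fin 2) : EuclideanSpace ℝ (Fin 2) →L[ℝ] ℝ) (Torus.partialDeriv 1 g x)
          from rfl, hc1, Torus.integral_partialDeriv_eq_zero_holds hgs 1]
      rfl
    simp only [hh_def]
    rw [integral_const_mul, integral_sub i0 i1, e0, e1, sub_zero, mul_zero]
  have hfinv : ∀ (s : UnitAddCircle) (x : UnitAddTorus (Fin 3)),
      Torus.twoHalf g h (x + Pi.single (2 : Fin 3) s) = Torus.twoHalf g h x := by
    intro s x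
    rw [Torus.twoHalf_eq_comp, Function.comp_apply, Function.comp_apply]
    exact Torus.comp_planarProj_add_single (fun y => Torus.planarEmbed (g y, h y)) s x
  have hfs : Torus.IsSmooth (Torus.twoHalf g h) := hgs.twoHalf hhs
  have hfd : Torus.IsDivFree (Torus.twoHalf g h) := Torus.IsDivFree.twoHalf hgd h
  have hfz : Torus.HasZeroMean (Torus.twoHalf g h) :=
    Torus.hasZeroMean_twoHalf hgs.continuous.integrable_unitAddTorus hhs.continuous.integrable_unitAddTorus hgz hhz
  -- restart every member of the family at a good `H¹` time `s j > 0`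
  have hrestart : ∀ j, ∃ s : ℝ, 0 < s ∧ Torus.eGradNormSq (u j s) < ⊤ ∧
      Torus.IsGlobalLerayHopf (ν j) (fun _ => Torus.twoHalf g h) (u j s) (fun t => u j (t + s)) :=
    fun j => (hLH j).exists_isGlobalLerayHopf_translate hfs (hν j).le
  choose s hs0 hsH1 hsLH using hrestart
  set ut : ℕ → ℝ → UnitAddTorus (Fin 3) → EuclideanSpace ℝ (Fin 3) := fun j t => u j (t + s j) with hut_def
  have hutinv : ∀ j (t : ℝ) (s' : UnitAddCircle) (x : UnitAddTorus (Fin 3)),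
      ut j t (x + Pi.single (2 : Fin 3) s') = ut j t x := fun j t s' x => huinv j (t + s j) s' x
  have hEt : ∃ E : ℝ, ∀ j, meanEnergy (ut j) ≤ E := by
    obtain ⟨E, hE⟩ := hE
    exact ⟨E, fun j => by rw [hut_def]; dsimp only; rw [(hLH j).meanEnergy_translate (hs0 j).le]; exact hE j⟩
  obtain ⟨g', h', v₀, v, θ₀, θ, hgs', hgd', hgz', hhs', hhz', hfeq, hsect, hvLH, hθ₀, hθw, hEv, hEθ, hsplit⟩ :=
    ReductionOffZero.stub_reductionOffZero (Torus.twoHalf g h) hfinv hfs hfd hfz ν (fun j => u j (s j)) ut hν hsLH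
      hutinv hEt
  obtain rfl : g = g' := Literature.Analysis.FluidPDE.Torus.twoHalf_left_injective hfeq
  have hh' : h = h' := Literature.Analysis.FluidPDE.Torus.twoHalf_right_injective hfeq
  subst hh'
  -- the planar solutions restart from `H¹` data `V j` (the planar sections of the 3-D slices `u j (s j)`)
  have hV : ∀ j, ∃ V : UnitAddTorus (Fin 2) → EuclideanSpace ℝ (Fin 2),
      MemLp V 2 volume ∧ Torus.eGradNormSq V < ⊤ ∧ Torus.IsGlobalLerayHopf (ν j) (fun _ => g) V (v j) ∧
        (AEStronglyMeasurable (v₀ j) volume → v₀ j =ᵐ[volume] V) := fun j =>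
    SectionDatumH1.stub_sectionDatumH1 (ν j) (Torus.twoHalf g h) (u j (s j)) (ut j) g (v₀ j) (v j) (θ j) (hsLH j)
      (fun s' x => huinv j (s j) s' x)
      (((hLH j) (s j + 1) (by linarith [hs0 j])).memLp (s j) ⟨(hs0 j).le, by linarith⟩) (hsH1 j) (hsect j) (hvLH j)
  choose V hV2 hVH1 hVLH _hVae using hV
  -- the `j`-uniform mean-enstrophy ceiling from the vorticity formulation and the co-scalar bound
  obtain ⟨Eθ, hEθ'⟩ := hEθ
  have hZ : ∀ j, longTimeAvgSup (fun t => (Torus.eGradNormSq (v j t)).toReal) ≤ 2 / c ^ 2 * Eθ := by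
    intro j
    obtain ⟨ω₀, hω₀, hω₀m, hωT⟩ :=
      VorticityTransport.stub_vorticityTransport (ν j) g (hν j) hgs hgd hgz (V j) (v j) (hV2 j) (hVH1 j) (hVLH j)
    have hB := CoscalarEnstrophyBound.stub_coscalarEnstrophyBound (ν j) c g (hν j) hc hgs hgd hgz (V j) (v j) (θ₀ j) (θ j) ω₀
      (hVLH j) (hθ₀ j) (hθw j) hω₀ hω₀m hωT
    refine hB.trans ?_
    exact mul_le_mul_of_nonneg_left (hEθ' j) (by positivity)
  -- Jensen: the `j`-uniform mean-strain ceiling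
  have hN : ∀ j, longTimeAvgSup (fun t => Real.sqrt (Torus.eGradNormSq (v j t)).toReal) ≤
      Real.sqrt (2 / c ^ 2 * Eθ + 1) := fun j =>
    Summit.AnomalousDissipation.AnomalousDissipation.Theorems.TwohalfdThesis.longTimeAvgSup_sqrt_le_sqrt_add_one
      (hν j) (hgs.memLp 2) hgz (hVLH j) (hZ j)
  -- `log(1/ν_j) → +∞`: sub-logarithmic strain
  have hν0' : Tendsto ν atTop (𝓝[>] 0) :=
    tendsto_nhdsWithin_iff.2 ⟨hν0, Eventually.of_forall fun j => hν j⟩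
  have hℓtop : Tendsto (fun j => Real.log (ν j)⁻¹) atTop atTop :=
    Real.tendsto_log_atTop.comp (tendsto_inv_nhdsGT_zero.comp hν0')
  have hup : Tendsto (fun j => Real.sqrt (2 / c ^ 2 * Eθ + 1) / Real.log (ν j)⁻¹) atTop (𝓝 0) :=
    tendsto_const_nhds.div_atTop hℓtop
  have hsub : Tendsto (fun j => longTimeAvgSup (fun t => Real.sqrt (Torus.eGradNormSq (v j t)).toReal) /
      Real.log (ν j)⁻¹) atTop (𝓝 0) := by
    refine squeeze_zero' ?_ ?_ hup
    · filter_upwards [hℓtop.eventually_ge_atTop 0] with j hj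
      exact div_nonneg (longTimeAvgSup_nonneg fun _ => Real.sqrt_nonneg _) hj
    · filter_upwards [hℓtop.eventually_ge_atTop 0] with j hj
      exact div_le_div_of_nonneg_right (hN j) hj
  -- the landed stubs S2, S4, S5', S3' and the squeeze
  have hplanar : Tendsto (fun j => meanDissipation (ν j) (v j)) atTop (𝓝 0) :=
    PlanarNoAnomaly.stub_planarNoAnomaly g hgs hgd hgz ν V v hν hν0 hVLH hEv
  have hquiet := QuietOfSubLogGrid.stub_quietOfSubLogGrid (ReleaseLogBound.stub_releaseLogBound (d := Fin 2))
    g hgs hgd hgz ν V v hν hν0 hVLH hEv hsub h hhs hhz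
  have hscalar : Tendsto (fun j => longTimeAvgSup
      (fun t => ν j * (Torus.eScalarGradNormSq (θ j t)).toReal)) atTop (𝓝 0) :=
    AgeDecouplingGrid.stub_ageDecouplingGrid g h hgs hgd hgz hhs hhz ν V v θ₀ θ hν hVLH hEv hθ₀ hθw ⟨Eθ, hEθ'⟩ hquiet
  have hsum : Tendsto (fun j => meanDissipation (ν j) (v j) +
      longTimeAvgSup (fun t => ν j * (Torus.eScalarGradNormSq (θ j t)).toReal)) atTop (𝓝 0) := by
    simpa using hplanar.add hscalar
  have ht : Tendsto (fun j => meanDissipation (ν j) (ut j)) atTop (𝓝 0) :=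
    squeeze_zero (fun j => meanDissipation_nonneg (hν j).le (ut j)) hsplit hsum
  refine ht.congr fun j => ?_
  rw [hut_def]
  exact (hLH j).meanDissipation_translate (hν j).le (hs0 j).le


/-- Registered tools stub (`ledger workitem stub-add stmt-AnomalousDissipation-0211 --name stub_coscalarCertificate …`):
the co-scalar sub-case of the crux. [folklore] -/
theorem stub_coscalarCertificate :
    ∀ (g : UnitAddTorus (Fin 2) → EuclideanSpace ℝ (Fin 2)) (c : ℝ),
      Torus.IsSmooth g → Torus.IsDivFree g → Torus.HasZeroMean g →
      ∀ (ν : ℕ → ℝ) (u₀ : ℕ → UnitAddTorus (Fin 3) → EuclideanSpace ℝ (Fin 3))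
        (u : ℕ → ℝ → UnitAddTorus (Fin 3) → EuclideanSpace ℝ (Fin 3)),
        (∀ j, 0 < ν j) → Tendsto ν atTop (𝓝 0) →
        (∀ j, Torus.IsGlobalLerayHopf (ν j)
          (fun _ => Torus.twoHalf g (fun x => c * (Torus.partialDeriv 0 g x 1 - Torus.partialDeriv 1 g x 0)))
          (u₀ j) (u j)) →
        (∀ j (t : ℝ) (s : UnitAddCircle) (x : UnitAddTorus (Fin 3)),
          u j t (x + Pi.single (2 : Fin 3) s) = u j t x) →
        (∃ E : ℝ, ∀ j, meanEnergy (u j) ≤ E) →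
        Tendsto (fun j => meanDissipation (ν j) (u j)) atTop (𝓝 0) :=
  twohalfdNeg_twoHalf_coscalar

end Summit.AnomalousDissipation.AnomalousDissipation.Theorems.TwohalfdNeg.Coscalar
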